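import Summits.Ventures.PercRepro.C025ProfileGenCapAB
import Summits.Ventures.PercRepro.C025ProfileGenCapC
import Summits.Ventures.PercRepro.C025ProfileGenDemD
import Summits.Ventures.PercRepro.C025ProfileRankFourDemC

/-!
# THE ROW (2,3) OF THE PROFILE INEQUALITY FOR EVERY FINITE MATROID (night-3 g8)

`proofs/NIGHT3-G8-GENERAL-CERTIFICATE.md`, assembled. On a simple matroid of rank `≥ 4` the closed-form certificate
`wgn` satisfies (Cap) — `cap_wgn_all`: `|S| = 3` (a), `|S| = 4` without / with a collinear triple (b) / (c), `|S| ≥ 5`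
(d) — and (Dem) — `dem_wgn_all`: `|B| ≥ 3` and `|B| = 2` with `j = 0, 1` from the rank-4 modules (the two rules agree
on these shapes, `wgn_eq_w4n_of_three_le_card_or_jB_le_one`), `j = 2` from `dem_wgn_of_jB_eq_two`. The double count
gives `(Π_{2,3})` on every simple matroid of rank `≥ 4`; rank `≤ 2` has an empty level `3`, rank `3` is the top level;
the tree's reduction `profileIneq_two_three_of_simple` then gives **`profileIneq_two_three`**: for EVERY finite matroid,
`Σ_{B : ρ(B) = 2} price(B) ≤ #{S : ρ(S) = 3}`, i.e. (`three_mul_card_levelSet_three_ge_all`)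
`3·#{S : ρ(S) = 3} ≥ Σ_{B : ρ(B) = 2, ρ(E∖B) ≥ 3} ρ(E∖B)` — the first open row of C-032, closed.
-/

open scoped Matroid

namespace PercRepro

open Set Finset ThmH

section Gen

variable {α : Type} [DecidableEq α] {M : Matroid α} [M.Finite]

/-- On a rank-`2` set with at least three points, or a pair with `j ≤ 1`, the general rule is the rank-`4` rule. -/
theorem wgn_eq_w4n_of_three_le_card_or_jB_le_one {B : Finset α} (h : 3 ≤ B.card ∨ jB M B ≤ 1) (S : Finset α) :
    wgn M B S = w4n M B S := by
  unfold wgn w4n wg w4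
  simp only
  by_cases hp : crk M B < 3
  · rw [if_pos hp, if_pos hp]
  rw [if_neg hp, if_neg hp]
  by_cases he1 : (S \ B).card = 1
  · rw [if_pos he1, if_pos he1]
    by_cases hB3 : 3 ≤ B.card
    · rw [if_pos hB3, if_pos hB3]
    · rw [if_neg hB3, if_neg hB3]
      have hj : jB M B ≤ 1 := by
        rcases h with h | h
        · exact absurd h hB3
        · exact h
      by_cases hj0 : jB M B = 0
      · rw [if_pos hj0, if_pos hj0]
      · rw [if_neg hj0, if_neg hj0, if_pos (by omega), if_pos (by omega)]
  · rw [if_neg he1, if_neg he1]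
    by_cases he2 : (S \ B).card = 2 ∧ B.card = 2
    · rw [if_pos he2, if_pos he2]
      have hj : jB M B ≤ 1 := by
        rcases h with h | h
        · omega
        · exact h
      by_cases hc : jB M B = 1 ∧ crk M S + 2 = crk M B
      · rw [if_pos hc, if_pos hc]
      · rw [if_neg hc, if_neg hc, if_neg (by omega), if_neg (by omega)]
    · rw [if_neg he2, if_neg he2]

/-- **(Cap) for every rank-`3` set** of a simple matroid of rank `≥ 4`. -/
theorem cap_wgn_all (hR : (4 : ℕ∞) ≤ M.eRank) (hsimple : ∀ T ⊆ M.E, T.encard ≤ 2 → M.Indep T) {S : Finset α}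
    (hS : S ∈ Shadow.levelSet M 3) : ∑ B ∈ (Profile.Rq M 2).filter (fun B => B ⊆ S), wgn M B S ≤ 3 := by
  classical
  have hSg : S ⊆ gr M := (Profile.mem_levelSet.1 hS).1
  have hS3 : M.eRk (S : Set α) = 3 := (Profile.mem_levelSet.1 hS).2
  have hS3c : 3 ≤ S.card := by
    have h := M.eRk_le_encard (S : Set α)
    rw [hS3, Set.encard_coe_eq_coe_finsetCard] at h
    exact_mod_cast h
  rcases Nat.lt_or_ge S.card 4 with h3 | h4
  · exact cap_wgn_of_card_three hsimple hS (by omega)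
  rcases Nat.lt_or_ge S.card 5 with h4' | h5
  · have hS4 : S.card = 4 := by omega
    by_cases htri : ∀ T ⊆ S, T.card = 3 → M.eRk (T : Set α) = 3
    · exact cap_wgn_card_four_of_no_triple hS4 htri
    · push Not at htri
      obtain ⟨T, hTS, hTc, hT3⟩ := htri
      have hT2 : M.eRk (T : Set α) = 2 := by
        have hle : M.eRk (T : Set α) ≤ 3 := by rw [← hS3]; exact M.eRk_mono (Finset.coe_subset.2 hTS)
        obtain ⟨U, hUT, hUc⟩ := Finset.exists_subset_card_eq (show 2 ≤ T.card by omega)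
        obtain ⟨a, b, hab, hU⟩ := Finset.card_eq_two.1 hUc
        have hge : (2 : ℕ∞) ≤ M.eRk (T : Set α) :=
          two_le_eRk_of_pair_subset hsimple (hTS.trans hSg) (hUT (by rw [hU]; exact Finset.mem_insert_self _ _))
            (hUT (by rw [hU]; exact Finset.mem_insert_of_mem (Finset.mem_singleton_self _))) hab
        have hfin : M.eRk (T : Set α) ≠ ⊤ := by
          rw [← lt_top_iff_ne_top]; exact (M.isRkFinite_set _).eRk_lt_top
        obtain ⟨n, hn⟩ := ENat.ne_top_iff_exists.1 hfin
        rw [← hn] at hle hge hT3 ⊢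
        have h1 : n ≤ 3 := by exact_mod_cast hle
        have h2 : 2 ≤ n := by exact_mod_cast hge
        have h3 : n ≠ 3 := fun h => hT3 (by rw [h]; rfl)
        have : n = 2 := by omega
        rw [this]; rfl
      exact cap_wgn_of_card_four_of_triple hR hsimple hS hS4 hTS hTc hT2
  · exact cap_wgn_of_five_le_card hR hsimple hS h5

/-- **(Dem) for every rank-`2` set** with `ρ(E∖B) ≥ 3` of a simple matroid of rank `≥ 4`. -/
theorem dem_wgn_all (hR : (4 : ℕ∞) ≤ M.eRank) (hsimple : ∀ T ⊆ M.E, T.encard ≤ 2 → M.Indep T) {B : Finset α}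
    (hB : B ∈ Profile.Rq M 2) (hp : 3 ≤ crk M B) :
    (crk M B : ℚ) ≤ ∑ S ∈ (Shadow.levelSet M 3).filter (fun S => B ⊆ S), wgn M B S := by
  have h2 := two_le_card_of_mem_Rq_two hB
  have hj2 : jB M B ≤ 2 := by unfold jB; exact min_le_left _ _
  by_cases hcase : 3 ≤ B.card ∨ jB M B ≤ 1
  · rw [Finset.sum_congr rfl (fun S _ => wgn_eq_w4n_of_three_le_card_or_jB_le_one hcase S)]
    rcases Nat.lt_or_ge B.card 3 with hlt | hge
    · have hBc : B.card = 2 := by omega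
      have hj : jB M B ≤ 1 := by
        rcases hcase with h | h
        · omega
        · exact h
      rcases Nat.lt_or_ge (jB M B) 1 with hj0 | hj1
      · exact dem_w4n_of_jB_eq_zero hsimple hB (by omega) hp
      · exact dem_w4n_of_jB_eq_one hB hBc (by omega) hp
    · exact dem_w4n_of_three_le_card hsimple hB hge hp
  · push Not at hcase
    exact dem_wgn_of_jB_eq_two hR hsimple hB (by omega) (by omega)

/-- `(Π_{2,3})` on every SIMPLE finite matroid: rank `≤ 2` (empty level), rank `3` (top level), rank `≥ 4` (the
certificate). -/
theorem profileIneq_two_three_of_simple_all (N : Matroid α) [N.Finite]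
    (hsimple : ∀ T ⊆ N.E, T.encard ≤ 2 → N.Indep T) : Profile.ProfileIneq N 2 3 := by
  have hRtop : N.eRank ≠ ⊤ := N.eRank_ne_top_iff.2 inferInstance
  obtain ⟨R, hRe⟩ := ENat.ne_top_iff_exists.1 hRtop
  rcases Nat.lt_or_ge R 3 with hlt3 | hge3
  · apply profileIneq_of_eRank_lt
    rw [← hRe]; exact_mod_cast hlt3
  rcases Nat.lt_or_ge R 4 with hlt4 | hge4
  · have heq3 : R = 3 := by omega
    exact Profile.profileIneq_top (R := 3) (by rw [← hRe, heq3]) 2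
  · have hR : (4 : ℕ∞) ≤ N.eRank := by rw [← hRe]; exact_mod_cast hge4
    exact profileIneq_two_three_of_certG (fun S hS => cap_wgn_all hR hsimple hS)
      (fun B hB hp => dem_wgn_all hR hsimple hB hp)

/-- **`(Π_{2,3})` FOR EVERY FINITE MATROID** (NIGHT3-G8-GENERAL-CERTIFICATE.md): the first open row of the profile
inequality `C025Profile`, closed by the closed-form local certificate `wgn`. -/
theorem profileIneq_two_three (M : Matroid α) [M.Finite] : Profile.ProfileIneq M 2 3 :=
  profileIneq_two_three_of_simple (fun N _ hs => profileIneq_two_three_of_simple_all N hs) M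

/-- The same in plain words: for every finite matroid,
`Σ_{B : ρ(B) = 2, ρ(E∖B) ≥ 3} ρ(E∖B) ≤ 3 · #{S : ρ(S) = 3}`. -/
theorem three_mul_card_levelSet_three_ge_all (M : Matroid α) [M.Finite] :
    ∑ B ∈ Profile.Rq M 2, (if 3 ≤ crk M B then (crk M B : ℚ) else 0) ≤ 3 * ((Shadow.levelSet M 3).card : ℚ) := by
  have h := profileIneq_two_three M
  unfold Profile.ProfileIneq at h
  have hsum : ∑ B ∈ Profile.Rq M 2, Profile.price M 2 3 B =
      (1 / 3 : ℚ) * ∑ B ∈ Profile.Rq M 2, (if 3 ≤ crk M B then (crk M B : ℚ) else 0) := by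
    rw [Finset.mul_sum]
    apply Finset.sum_congr rfl
    intro B _
    rw [price_two_three_eq]
    split_ifs <;> ring
  rw [hsum] at h
  linarith

end Gen

end PercRepro
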